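import Literature.NumberTheory.Automorphic.UnitaryGroupAutomorphicRep
import Literature.NumberTheory.Automorphic.GlobalAdditiveCharacter
import Literature.NumberTheory.Automorphic.WhittakerModels
import Literature.NumberTheory.Automorphic.AdeleBaseChange
import HarnessLib

/-!
# Global genericity of automorphic representations of the quasi-split unitary group `U_{E/F}(N)`

Topic `NumberTheory/Automorphic`; namespace `Literature.NumberTheory.Automorphic.UnitaryGroup`
(grouping sub-namespace of `UnitaryGroupAutomorphicRep`). Definition request
`defn-UnitaryGroup.IsGeneric` (route `Langlands/QuadraticWindow`, crux `HostInducedRep`, line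
"generic descent without endoscopy"). Everything here is a definition or a proved lemma: **no named
facts, no `sorry`**.

**Setting.** `E/F` number fields with `c : E ≃ₐ[F] E` (meaningful for `[E : F] = 2`, `c ≠ 1`),
`G = U_{E/F}(N) = U(J_N)` Mok's quasi-split unitary group of the anti-diagonal Hermitian form
`J_N = antidiag(1, …, 1)` (accepted `UnitaryGroup.quasiSplit`, `quasiSplitDatum`; Mok 2014, §1
*Notation*, p. 5), with its standard Borel `B = T N` = upper triangular matrices of `GL_N(E)` meeting
`U(J_N)` (Mok 2014, §3.1: "the standard diagonal maximal torus, the standard upper triangular Borel").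

## Contents

* `UnitaryGroup.adelicUnipotent` — `N(𝔸_F) = U(J_N)(𝔸_F) ∩ N_N(𝔸_E)` (upper unitriangular
  elements of the adelic group, accepted `upperUnitriangular` pulled back along `adelicVal`),
  `rationalUnipotent` — `N(F) ≤ N(𝔸_F)` (elements in the arithmetic subgroup), `toUnitriangular`.
* **Root coordinates** (0-based indices). For `u ∈ N(𝔸_F)` the unitarity relation
  `ᵗc(u) J_N u = J_N` pairs the super-diagonal entries: `u_{N-2-i, N-1-i} = -c(u_{i, i+1})`. Hence
  the abelianisation of `N` is the sum of the simple (relative) root spaces: the FREE coordinates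
  `u_{i,i+1} ∈ 𝔸_E` for `2i + 2 < N` (roots `e_i - e_{i+1}` of `Res_{E/F}` type), and, for
  `N = 2m` even, the MIDDLE coordinate `u_{m-1,m}` with `c(u_{m-1,m}) = -u_{m-1,m}` (the long root
  `2e_m` of the relative system `C_m`; a trace-zero element, `conjAdele_middleEntry` below). We set
  `rootSum u = ∑_{2i+2<N} u_{i,i+1}` and `middleEntry u = u_{N/2-1,N/2}` (`0` for `N` odd).
* **Generic characters** `genericChar ψ ψ₀ u = ψ(rootSum u) · ψ₀(middleEntry u)` for a pair of
  additive characters of `𝔸_E`, and the predicate `IsWhittakerDatum F E N ψ ψ₀`: `ψ` is a global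
  additive character of `E` (accepted `IsGlobalAddChar`: continuous, trivial on `E`, non-trivial) and,
  WHEN `N` IS EVEN, `ψ₀` is a non-trivial character of `𝔸_E / (E + 𝔸_F)` (`IsGlobalAddCharModBase`:
  a global additive character of `E` trivial on the base-changed adeles `AdeleRing.baseChange F E`).
  This is the automorphic generic character of Gan–Gross–Prasad (2012), §12 and §23, for the
  Hermitian space `(E^N, J_N)`: on the `E`-valued simple-root coordinates `x_i` the character
  `ψ(∑ x_i)` (§12: "`λ(u) = ψ(Tr(∑ x_i))`", i.e. `ψ_E = ψ_F ∘ Tr_{E/F}`; any global `ψ_E` is allowed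
  here, which changes nothing up to `T(F)`-conjugacy), and on the last coordinate, whose values are
  trace-zero in the Hermitian case (§12, Remark: "the image of `f₀` lies in the subspace of trace zero
  elements of `k`"; "giving a `T`-orbit of generic characters of `N` in the even hermitian case amounts
  to giving a nontrivial character of `k` trivial on `k₀`"), a character `ψ₀ : 𝔸_E/(E + 𝔸) → 𝕊¹`
  (§23: "in the hermitian case, we compose `λ_𝔸` with a fixed nontrivial additive character
  `ψ₀ : 𝔸_E/(E + 𝔸) → 𝕊¹`"). It is also Mok's standard Whittaker datum `(B, λ)`,
  `λ(n) = ψ_F(∑_{α ∈ Δ} x_α(n))` for an `F`-splitting (Mok 2014, §3.1–3.2; Kottwitz–Shelstad §5.3):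
  for `J_N` an `F`-splitting has root vectors `E_{i,i+1}`, `-E_{N-2-i,N-1-i}` (`2i+2<N`) and `δ E_{m-1,m}`
  (`c δ = -δ`, `N = 2m`), giving `λ(n) = ψ_F(∑_{2i+2<N} Tr n_{i,i+1} + n_{m-1,m}/δ)`, which is
  `genericChar (ψ_F ∘ Tr) ψ₀` with `ψ₀(x) = ψ_F(Tr(x/2δ))`, a character of `𝔸_E/(E + 𝔸_F)`. For `N` odd
  there is a single `T(F)`-orbit of generic characters; for `N` even there are two
  (`F^× / N E^×`; GGP §12, Prop. 12.1: "`D ⟷ N k^×`-orbits on nontrivial `ψ : k/k₀ → ℂ`" in the even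
  hermitian case), whence the existential over Whittaker data in `IsGeneric`.
  API: `genericChar_mul`, `genericChar_one`, `norm_genericChar`, and
  `genericChar_eq_one_of_mem_rationalUnipotent` (**`N(F)`-invariance**, from `ψ|_E = ψ₀|_E = 1`).
* **The Whittaker–Fourier coefficient** `whittakerCoeff ν 𝓕 ψ ψ₀ φ g =
  (ν 𝓕)⁻¹ ∫_𝓕 φ(u g) conj(genericChar ψ ψ₀ u) dν(u)` — GGP §22: "`f ↦ ∫_{U(F)\U(𝔸)} f(u) θ̄(u) du` …
  the `θ`-Fourier coefficient" — with the compact quotient `N(F) \ N(𝔸_F)` realised, exactly as in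
  the accepted `CuspCondition` of `UnitaryGroupAutomorphicRep` and `whittakerCoeff` of
  `GlobalWhittakerCoefficient` (`GL_n`), by a Haar measure `ν` of `N(𝔸_F)` and a fundamental domain
  `𝓕` of `N(F)`, normalised to mass one. `whittakerIntegrand_smul` (the integrand is
  `N(F)`-invariant for `φ` left `U(F)`-invariant) and `whittakerCoeff_eq_of_isFundamentalDomain`
  (independence of `𝓕`) are proved.
* **Genericity.** `HasNonzeroWhittakerCoeff F E c N ψ ψ₀ φ`: for every Borel structure, Haar
  measure and fundamental domain, `W_φ(g) ≠ 0` for some `g` (the `θ`-Fourier coefficient does not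
  vanish on the `N(𝔸_F)`-translates of `φ`). For automorphic representation DATA `π = W/W'` of
  `quasiSplitDatum` (accepted `AutomorphicRepData`): `IsGenericFor F E c N hcpt ψ ψ₀ π` — some
  `φ ∈ W ∖ W'` has, together with its whole coset `φ + W'`, a non-vanishing `θ`-coefficient (for a
  subrepresentation, `W' = ⊥`, this is literally GGP §22: "if `F(θ)` is nonzero when restricted to
  `π ⊂ 𝒜(G)`, we say that `π` is globally generic with respect to `θ`",
  `isGenericFor_iff_of_eq_bot`; for a genuine subquotient it says that the Whittaker map
  `φ ↦ W_φ` of `W` does not factor through `W'`, i.e. `π` has an automorphic `θ`-Whittaker model) —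
  and **`UnitaryGroup.IsGeneric F E c N hcpt π`**: `π` is globally generic with respect to SOME
  Whittaker datum (the wanted notion).

## Design notes

* Typing as in `UnitaryGroupAutomorphicRep`: group elements live in `(quasiSplit F E c N).Adelic`,
  matrix entries are read through `adelicVal`. Sums over the super-diagonal are double sums
  `∑ i j, if i + 1 = j ∧ … then u i j else 0` (no `ℕ`-subtraction, cf. `superdiagSum`).
* `∀` over the measure-theoretic set-up (Borel structure, Haar measure, fundamental domain), as in
  the accepted `CuspCondition`: the value of `whittakerCoeff` does not depend on `𝓕`
  (`whittakerCoeff_eq_of_isFundamentalDomain`) and scales with `ν`, so non-vanishing is set-up free;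
  the universal form is the one consumers need.
* `ψ₀` is an argument for every `N` and constrained only for even `N` (`IsWhittakerDatum`); for odd
  `N`, `middleEntry = 0` (`middleEntry_eq_zero_of_odd`) and `ψ₀` does not enter `genericChar`.
  Degenerate ranks: for `N ≤ 1`, `N` is trivial and every `φ` with `φ(g) ≠ 0` somewhere is generic.
* Junk values: `whittakerCoeff` is `0` if `ν 𝓕 ∈ {0, ∞}` (`toReal⁻¹`), which does not happen for a
  Haar measure and a fundamental domain of the cocompact lattice `N(F)`.

## What is NOT here

* The theorems these notions serve (Ginzburg–Rallis–Soudry descent `GL_N → U_N` produces generic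
  cuspidal `σ`, GRS 2011, Ch. 3 and Thm. 9.7; uniqueness of generic members of packets, Mok 2014,
  §2.5 / GGP §17–§18; strong multiplicity one for generic cuspidal representations) — cite items.
* Local genericity of the components `π_v` (the accepted `Representation.IsGeneric` pattern of
  `WhittakerModels` applies to `U(J_N)(F_v) ≤ GL_N(E_v)` verbatim once wanted).
* Existence of a fundamental domain for `N(F) \ N(𝔸_F)` and `N(𝔸_F)`-equivariance
  `W_φ(u g) = θ(u) W_φ(g)` (needs left-invariance of `ν`); not needed by the definitions.

## References

* W. T. Gan, B. H. Gross, D. Prasad, *Symplectic local root numbers, central critical L-values, and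
  restriction problems in the representation theory of classical groups*, Astérisque 346 (2012),
  §12 (generic characters of `U(V)`, Prop. 12.1), §22 (`θ`-Fourier coefficient, globally generic),
  §23 (automorphic generic character, hermitian case `ψ₀ : 𝔸_E/(E + 𝔸) → 𝕊¹`). [GanGrossPrasad2012]
* C. P. Mok, *Endoscopic classification of representations of quasi-split unitary groups*, Mem. AMS
  235 (2015), no. 1108, §1 Notation (p. 5), §2.5, §3.1–3.2 (standard Whittaker datum `(B, λ)`).
  [Mok2014]
* D. Ginzburg, S. Rallis, D. Soudry, *The descent map from automorphic representations of GL(n) to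
  classical groups*, World Scientific (2011), Ch. 3 (Whittaker coefficients on unitary groups).
  [GinzburgRallisSoudry2011]
* J. W. Cogdell, *Analytic theory of L-functions for GL_n* (2004), §1.1 (the `GL_n` model followed
  by `GlobalWhittakerCoefficient`). [CogdellAnalyticTheory2004]
-/

noncomputable section

open scoped MatrixGroups Matrix ComplexConjugate
open NumberField IsDedekindDomain
open _root_.MeasureTheory

namespace Literature.NumberTheory.Automorphic

namespace UnitaryGroup

open scoped Classical

variable (F E : Type) [Field F] [NumberField F] [Field E] [NumberField E] [Algebra F E]
  (c : E ≃ₐ[F] E) (N : ℕ)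

/-! ## The maximal unipotent subgroup `N = U(J_N) ∩ N_N` and its rational points -/

/-- The unipotent radical `N(𝔸_F) = U_{E/F}(N)(𝔸_F) ∩ N_N(𝔸_E)` of the standard (upper triangular)
Borel subgroup of Mok's quasi-split unitary group: the adelic points of `U(J_N)` which are upper
unitriangular in `GL_N(𝔸_E)` (accepted `upperUnitriangular`, pulled back along `adelicVal`).
Mok 2014, §3.1 ("`B` the standard upper triangular Borel subgroup", "`N_B` the unipotent radical of
`B`"). [cite: Mok2014, §3.1] -/
def adelicUnipotent : Subgroup (quasiSplit F E c N).Adelic :=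
  (upperUnitriangular (Fin N) (AdeleRing (𝓞 E) E)).comap (adelicVal F E c N _)

/-- The rational points `N(F) ≤ N(𝔸_F)`: the elements of `N(𝔸_F)` lying in the arithmetic subgroup
`U(F) ≤ U(𝔸_F)` (diagonally embedded), a discrete cocompact subgroup. [folklore] -/
def rationalUnipotent : Subgroup (adelicUnipotent F E c N) :=
  ((quasiSplit F E c N).arithmeticSubgroup).comap (adelicUnipotent F E c N).subtype

/-- `N(𝔸_F) →* N_N(𝔸_E)`: an element of `N(𝔸_F)` as an upper unitriangular adelic matrix. [folklore] -/
def toUnitriangular : adelicUnipotent F E c N →* upperUnitriangular (Fin N) (AdeleRing (𝓞 E) E) :=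
  (adelicVal F E c N _).subgroupComap _

variable {F E c N}

/-- `toUnitriangular u` is `adelicVal u` (definitional). [folklore] -/
@[simp] theorem coe_toUnitriangular (u : adelicUnipotent F E c N) :
    ((toUnitriangular F E c N u : upperUnitriangular (Fin N) (AdeleRing (𝓞 E) E)) :
      GL (Fin N) (AdeleRing (𝓞 E) E)) = adelicVal F E c N _ (u : (quasiSplit F E c N).Adelic) :=
  rfl

/-- Membership in `N(𝔸_F)`: the adelic matrix is upper unitriangular. [folklore] -/
theorem mem_adelicUnipotent_iff (g : (quasiSplit F E c N).Adelic) :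
    g ∈ adelicUnipotent F E c N ↔
      adelicVal F E c N _ g ∈ upperUnitriangular (Fin N) (AdeleRing (𝓞 E) E) :=
  Iff.rfl

/-- Membership in `N(F)`: `u` is the diagonal image of a rational point of `U(J_N)`. [folklore] -/
theorem mem_rationalUnipotent_iff (u : adelicUnipotent F E c N) :
    u ∈ rationalUnipotent F E c N ↔
      ∃ γ : rational F E c N ((StdForm.antidiagonal N).over E),
        (toAdelic F E c N _ γ : (quasiSplit F E c N).Adelic) = (u : (quasiSplit F E c N).Adelic) :=
  Iff.rfl

/-- Entries of a rational unipotent element are principal adeles: if `γ ∈ U(F)` maps to `u` then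
`u_{ij} = (γ_{ij})_{𝔸_E}`. [folklore] -/
theorem adelicVal_apply_eq_algebraMap {u : adelicUnipotent F E c N}
    {γ : rational F E c N ((StdForm.antidiagonal N).over E)}
    (hγ : (toAdelic F E c N _ γ : (quasiSplit F E c N).Adelic) = (u : (quasiSplit F E c N).Adelic))
    (i j : Fin N) :
    (adelicVal F E c N _ (u : (quasiSplit F E c N).Adelic) : Matrix (Fin N) (Fin N) _) i j =
      algebraMap E (AdeleRing (𝓞 E) E) (((γ : GL (Fin N) E) : Matrix (Fin N) (Fin N) E) i j) := by
  rw [← hγ]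
  rfl

/-! ## Simple-root coordinates and the generic character -/

/-- The **sum of the free simple-root coordinates** `∑_{2i+2<N} u_{i,i+1} ∈ 𝔸_E` of `u ∈ N(𝔸_F)`
(0-based indices): the super-diagonal entries in the first half, one from each pair
`{u_{i,i+1}, u_{N-2-i,N-1-i} = -c(u_{i,i+1})}` (GGP 2012, §12: the coordinates
`x_i = ⟨u v_{i+1}, v'_i⟩`, `ℓ(u) = Tr(∑ x_i)`). [cite: GanGrossPrasad2012, §12] -/
def rootSum (u : adelicUnipotent F E c N) : AdeleRing (𝓞 E) E :=
  ∑ i : Fin N, ∑ j : Fin N,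
    if (i : ℕ) + 1 = j ∧ 2 * (i : ℕ) + 2 < N then
      (adelicVal F E c N _ (u : (quasiSplit F E c N).Adelic) : Matrix (Fin N) (Fin N) _) i j
    else 0

/-- The **middle coordinate** `u_{N/2-1, N/2} ∈ 𝔸_E` of `u ∈ N(𝔸_F)` for `N` even (the coordinate
of the long simple root `2e_{N/2}`; it satisfies `c(u_{N/2-1,N/2}) = -u_{N/2-1,N/2}`), and `0` for
`N` odd (GGP 2012, §12: the map `f₀ : N₀ → k`, with image in the trace-zero elements in the
Hermitian case). [cite: GanGrossPrasad2012, §12] -/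
def middleEntry (u : adelicUnipotent F E c N) : AdeleRing (𝓞 E) E :=
  ∑ i : Fin N, ∑ j : Fin N,
    if (i : ℕ) + 1 = j ∧ 2 * (i : ℕ) + 2 = N then
      (adelicVal F E c N _ (u : (quasiSplit F E c N).Adelic) : Matrix (Fin N) (Fin N) _) i j
    else 0

/-- Unfolding `rootSum`. [folklore] -/
theorem rootSum_def (u : adelicUnipotent F E c N) :
    rootSum u = ∑ i : Fin N, ∑ j : Fin N,
      if (i : ℕ) + 1 = j ∧ 2 * (i : ℕ) + 2 < N then
        (adelicVal F E c N _ (u : (quasiSplit F E c N).Adelic) : Matrix (Fin N) (Fin N) _) i j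
      else 0 :=
  rfl

/-- Unfolding `middleEntry`. [folklore] -/
theorem middleEntry_def (u : adelicUnipotent F E c N) :
    middleEntry u = ∑ i : Fin N, ∑ j : Fin N,
      if (i : ℕ) + 1 = j ∧ 2 * (i : ℕ) + 2 = N then
        (adelicVal F E c N _ (u : (quasiSplit F E c N).Adelic) : Matrix (Fin N) (Fin N) _) i j
      else 0 :=
  rfl

/-- For `N` odd there is no middle coordinate: `middleEntry u = 0`. [folklore] -/
theorem middleEntry_eq_zero_of_odd (hN : Odd N) (u : adelicUnipotent F E c N) : middleEntry u = 0 := by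
  refine Finset.sum_eq_zero fun i _ => Finset.sum_eq_zero fun j _ => ?_
  rw [if_neg]
  rintro ⟨-, h⟩
  obtain ⟨k, hk⟩ := hN
  omega

/-- `rootSum` is additive: `(u v)_{i,i+1} = u_{i,i+1} + v_{i,i+1}` for unitriangular matrices
(accepted `upperUnitriangular_mul_apply_superdiag`). [folklore] -/
theorem rootSum_mul (u v : adelicUnipotent F E c N) : rootSum (u * v) = rootSum u + rootSum v := by
  simp only [rootSum, ← Finset.sum_add_distrib]
  refine Finset.sum_congr rfl fun i _ => Finset.sum_congr rfl fun j _ => ?_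
  split_ifs with h
  · have key := upperUnitriangular_mul_apply_superdiag (toUnitriangular F E c N u)
      (toUnitriangular F E c N v) i j h.1
    rw [← map_mul] at key
    exact key
  · rw [add_zero]

/-- `middleEntry` is additive. [folklore] -/
theorem middleEntry_mul (u v : adelicUnipotent F E c N) :
    middleEntry (u * v) = middleEntry u + middleEntry v := by
  simp only [middleEntry, ← Finset.sum_add_distrib]
  refine Finset.sum_congr rfl fun i _ => Finset.sum_congr rfl fun j _ => ?_
  split_ifs with h
  · have key := upperUnitriangular_mul_apply_superdiag (toUnitriangular F E c N u)
      (toUnitriangular F E c N v) i j h.1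
    rw [← map_mul] at key
    exact key
  · rw [add_zero]

/-- `rootSum 1 = 0`. [folklore] -/
@[simp] theorem rootSum_one : rootSum (1 : adelicUnipotent F E c N) = 0 := by
  refine Finset.sum_eq_zero fun i _ => Finset.sum_eq_zero fun j _ => ?_
  split_ifs with h
  · have hne : i ≠ j := by
      rintro rfl
      omega
    simp [Matrix.one_apply_ne hne]
  · rfl

/-- `middleEntry 1 = 0`. [folklore] -/
@[simp] theorem middleEntry_one : middleEntry (1 : adelicUnipotent F E c N) = 0 := by
  refine Finset.sum_eq_zero fun i _ => Finset.sum_eq_zero fun j _ => ?_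
  split_ifs with h
  · have hne : i ≠ j := by
      rintro rfl
      omega
    simp [Matrix.one_apply_ne hne]
  · rfl

/-! ### The unitarity relation on the super-diagonal -/

/-- **Entries of the unitarity relation for the anti-diagonal form.** For `g ∈ U(J_N)(𝔸_F)` and
indices `a, b`: `∑_k c(g_{k a}) g_{N-1-k, b} = δ_{b, N-1-a}` — the `(a, b)` entry of
`ᵗ(c g) J_N g = J_N` with `(J_N)_{k l} = δ_{l, N-1-k}` (Mok 2014, §1, p. 5). [cite: Mok2014, §1 Notation p. 5] -/
theorem sum_conjAdele_mul_rev_eq (g : (quasiSplit F E c N).Adelic) (a b : Fin N) :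
    ∑ k : Fin N, conjAdele F E c ((adelicVal F E c N _ g : Matrix (Fin N) (Fin N) _) k a) *
        (adelicVal F E c N _ g : Matrix (Fin N) (Fin N) _) k.rev b =
      if b = a.rev then 1 else 0 := by
  have hJap : ∀ k l : Fin N,
      ((StdForm.antidiagonal N).over (AdeleRing (𝓞 E) E)) k l = if l = k.rev then 1 else 0 := by
    intro k l
    simp only [StdForm.over, Matrix.map_apply, StdForm.antidiagonal_J_apply]
    split_ifs <;> simp
  have hcond : ∀ k l : Fin N, (l = k.rev) = (k = l.rev) := fun k l =>
    propext (by rw [eq_comm, Fin.rev_eq_iff])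
  have key := congrFun (congrFun (mem_unitaryGroupOfForm_iff.1 g.2) a) b
  rw [← adelicVal_apply, adelicForm_over, hJap] at key
  rw [← key]
  simp only [Matrix.mul_apply, Matrix.transpose_apply, Matrix.map_apply, hJap, mul_ite, mul_one,
    mul_zero, hcond, Finset.sum_ite_eq', Finset.mem_univ, if_true]
  exact Fintype.sum_equiv Fin.revPerm _ _ fun k => by simp only [Fin.revPerm_apply, Fin.rev_rev]

/-- **The super-diagonal entries of `u ∈ N(𝔸_F)` pair up under `c`**: `u_{N-2-i, N-1-i} = -c(u_{i,i+1})`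
(0-based; the `(i+1, N-1-i)` entry of `ᵗ(c u) J_N u = J_N` for a unitriangular `u`). In particular
the relative simple-root coordinates are `u_{i,i+1}`, `2i + 2 ≤ N`. [folklore] -/
theorem apply_rev_rev_eq_neg_conjAdele (u : adelicUnipotent F E c N) {i j : Fin N}
    (hij : (i : ℕ) + 1 = j) :
    (adelicVal F E c N _ (u : (quasiSplit F E c N).Adelic) : Matrix (Fin N) (Fin N) _) j.rev i.rev =
      -conjAdele F E c
        ((adelicVal F E c N _ (u : (quasiSplit F E c N).Adelic) : Matrix (Fin N) (Fin N) _) i j) := by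
  have hne : i ≠ j := by
    rintro rfl
    omega
  obtain ⟨hut, hu1⟩ := (mem_upperUnitriangular_iff _).1 ((mem_adelicUnipotent_iff _).1 u.2)
  have key := sum_conjAdele_mul_rev_eq (u : (quasiSplit F E c N).Adelic) j i.rev
  rw [if_neg (fun h => hne (Fin.rev_injective h)), Finset.sum_eq_add i j hne] at key
  · simp only [hu1, map_one, mul_one, one_mul] at key
    exact (neg_eq_iff_add_eq_zero.2 key).symm
  · rintro k - ⟨hki, hkj⟩
    by_cases hk : (j : ℕ) < k
    · rw [hut (show id j < id k from hk), map_zero, zero_mul]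
    · have hki' : (k : ℕ) < i := by
        have h1 : (k : ℕ) ≠ i := fun h => hki (Fin.ext h)
        have h2 : (k : ℕ) ≠ j := fun h => hkj (Fin.ext h)
        omega
      have hrev : i.rev < k.rev := Fin.rev_lt_rev.2 hki'
      rw [hut (show id i.rev < id k.rev from hrev), mul_zero]
  · exact fun h => absurd (Finset.mem_univ i) h
  · exact fun h => absurd (Finset.mem_univ j) h

/-- **The middle coordinate is trace-zero**: `c(middleEntry u) = -middleEntry u` (for `N = 2m` the
entry `u_{m-1,m}` is paired with itself), which is why the generic character applies to it a
character of `𝔸_E` trivial on `𝔸_F` (`IsGlobalAddCharModBase`; GGP 2012, §12, Remark: "the image of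
`f₀` lies in the subspace of trace zero elements"). [cite: GanGrossPrasad2012, §12] -/
theorem conjAdele_middleEntry (u : adelicUnipotent F E c N) :
    conjAdele F E c (middleEntry u) = -middleEntry u := by
  rw [middleEntry, map_sum, ← Finset.sum_neg_distrib]
  refine Finset.sum_congr rfl fun i _ => ?_
  rw [map_sum, ← Finset.sum_neg_distrib]
  refine Finset.sum_congr rfl fun j _ => ?_
  split_ifs with h
  · obtain ⟨hij, hN⟩ := h
    have hjrev : j.rev = i := Fin.ext (by rw [Fin.val_rev]; omega)
    have hirev : i.rev = j := Fin.ext (by rw [Fin.val_rev]; omega)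
    have key := apply_rev_rev_eq_neg_conjAdele u hij
    rw [hjrev, hirev] at key
    exact (neg_eq_iff_eq_neg.2 key).symm
  · rw [map_zero, neg_zero]

/-- The **generic character** `θ_{ψ,ψ₀} : N(𝔸_F) → ℂ`,
`θ(u) = ψ(∑_{2i+2<N} u_{i,i+1}) · ψ₀(u_{N/2-1,N/2})`, attached to a pair of additive characters
of `𝔸_E`: `ψ` on the free simple-root coordinates and `ψ₀` on the (trace-zero) middle coordinate
for `N` even (for `N` odd the second factor is `ψ₀(0) = 1`). For a Whittaker datum
(`IsWhittakerDatum`) this is the automorphic generic character `θ = ψ ∘ λ_𝔸` of Gan–Gross–Prasad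
(2012), §12 (`λ(u) = ψ(Tr ∑ x_i)` and, in the even hermitian case, "a nontrivial character of `k`
trivial on `k₀`" on `f₀`) and §23, equivalently Mok's standard Whittaker datum `(B, λ)`,
`λ(n) = ψ_F(∑_α x_α(n))` (Mok 2014, §3.1). [cite: GanGrossPrasad2012, §12 and §23] -/
def genericChar (ψ ψ₀ : AddChar (AdeleRing (𝓞 E) E) Circle) (u : adelicUnipotent F E c N) : ℂ :=
  ((ψ (rootSum u) : Circle) : ℂ) * ((ψ₀ (middleEntry u) : Circle) : ℂ)

/-- Unfolding `genericChar`. [folklore] -/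
theorem genericChar_apply (ψ ψ₀ : AddChar (AdeleRing (𝓞 E) E) Circle) (u : adelicUnipotent F E c N) :
    genericChar ψ ψ₀ u = ((ψ (rootSum u) : Circle) : ℂ) * ((ψ₀ (middleEntry u) : Circle) : ℂ) :=
  rfl

/-- `θ` is multiplicative: `θ(u v) = θ(u) θ(v)` (it is a character of `N(𝔸_F)`, factoring through
the abelianisation). [folklore] -/
theorem genericChar_mul (ψ ψ₀ : AddChar (AdeleRing (𝓞 E) E) Circle) (u v : adelicUnipotent F E c N) :
    genericChar ψ ψ₀ (u * v) = genericChar ψ ψ₀ u * genericChar ψ ψ₀ v := by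
  simp only [genericChar, rootSum_mul, middleEntry_mul, AddChar.map_add_eq_mul, Circle.coe_mul]
  ring

/-- `θ(1) = 1`. [folklore] -/
@[simp] theorem genericChar_one (ψ ψ₀ : AddChar (AdeleRing (𝓞 E) E) Circle) :
    genericChar ψ ψ₀ (1 : adelicUnipotent F E c N) = 1 := by
  rw [genericChar, rootSum_one, middleEntry_one, AddChar.map_zero_eq_one, AddChar.map_zero_eq_one,
    Circle.coe_one, mul_one]

/-- `θ` takes values of norm one. [folklore] -/
theorem norm_genericChar (ψ ψ₀ : AddChar (AdeleRing (𝓞 E) E) Circle) (u : adelicUnipotent F E c N) :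
    ‖genericChar ψ ψ₀ u‖ = 1 := by
  rw [genericChar, norm_mul, Circle.norm_coe, Circle.norm_coe, mul_one]

/-- `θ` is nowhere zero. [folklore] -/
theorem genericChar_ne_zero (ψ ψ₀ : AddChar (AdeleRing (𝓞 E) E) Circle) (u : adelicUnipotent F E c N) :
    genericChar ψ ψ₀ u ≠ 0 :=
  mul_ne_zero (Circle.coe_ne_zero _) (Circle.coe_ne_zero _)

/-- For `N` odd, `θ_{ψ,ψ₀} = ψ ∘ rootSum` does not depend on `ψ₀`. [folklore] -/
theorem genericChar_eq_of_odd (hN : Odd N) (ψ ψ₀ : AddChar (AdeleRing (𝓞 E) E) Circle)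
    (u : adelicUnipotent F E c N) : genericChar ψ ψ₀ u = ((ψ (rootSum u) : Circle) : ℂ) := by
  rw [genericChar, middleEntry_eq_zero_of_odd hN, AddChar.map_zero_eq_one, Circle.coe_one, mul_one]

/-- **The generic character is trivial on `N(F)`**: if `ψ` and `ψ₀` are trivial on the principal
adeles `E ↪ 𝔸_E`, then `θ(u) = 1` for `u ∈ N(F)` (its coordinates are principal adeles), so `θ` is
an automorphic character of `N(F) \ N(𝔸_F)` (GGP 2012, §23: `θ : U(F) \ U(𝔸) → 𝕊¹`). [cite: GanGrossPrasad2012, §23] -/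
theorem genericChar_eq_one_of_mem_rationalUnipotent {ψ ψ₀ : AddChar (AdeleRing (𝓞 E) E) Circle}
    (hψ : ∀ e : E, ψ (algebraMap E (AdeleRing (𝓞 E) E) e) = 1)
    (hψ₀ : ∀ e : E, ψ₀ (algebraMap E (AdeleRing (𝓞 E) E) e) = 1)
    {u : adelicUnipotent F E c N} (hu : u ∈ rationalUnipotent F E c N) :
    genericChar ψ ψ₀ u = 1 := by
  obtain ⟨γ, hγ⟩ := (mem_rationalUnipotent_iff u).1 hu
  have hent := adelicVal_apply_eq_algebraMap hγ
  have hsum : ∀ P : Fin N → Fin N → Prop, ∀ [∀ i j, Decidable (P i j)],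
      (∑ i : Fin N, ∑ j : Fin N,
        if P i j then
          (adelicVal F E c N _ (u : (quasiSplit F E c N).Adelic) : Matrix (Fin N) (Fin N) _) i j
        else 0) =
      algebraMap E (AdeleRing (𝓞 E) E) (∑ i : Fin N, ∑ j : Fin N,
        if P i j then ((γ : GL (Fin N) E) : Matrix (Fin N) (Fin N) E) i j else 0) := by
    intro P _
    rw [map_sum]
    refine Finset.sum_congr rfl fun i _ => ?_
    rw [map_sum]
    refine Finset.sum_congr rfl fun j _ => ?_
    split_ifs with h
    · exact hent i j
    · rw [map_zero]
  have h1 : rootSum u = algebraMap E (AdeleRing (𝓞 E) E) (∑ i : Fin N, ∑ j : Fin N,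
      if (i : ℕ) + 1 = j ∧ 2 * (i : ℕ) + 2 < N then
        ((γ : GL (Fin N) E) : Matrix (Fin N) (Fin N) E) i j else 0) :=
    hsum (fun i j => (i : ℕ) + 1 = j ∧ 2 * (i : ℕ) + 2 < N)
  have h2 : middleEntry u = algebraMap E (AdeleRing (𝓞 E) E) (∑ i : Fin N, ∑ j : Fin N,
      if (i : ℕ) + 1 = j ∧ 2 * (i : ℕ) + 2 = N then
        ((γ : GL (Fin N) E) : Matrix (Fin N) (Fin N) E) i j else 0) :=
    hsum (fun i j => (i : ℕ) + 1 = j ∧ 2 * (i : ℕ) + 2 = N)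
  rw [genericChar, h1, h2, hψ, hψ₀, Circle.coe_one, mul_one]

/-! ## The Whittaker–Fourier coefficient -/

section Coefficient

variable [MeasurableSpace (adelicUnipotent F E c N)]

/-- **The `θ`-Whittaker–Fourier coefficient** of `φ : U_{E/F}(N)(𝔸_F) → ℂ` along `N`:
`W_φ(g) = ∫_{N(F) \ N(𝔸_F)} φ(u g) θ(u)⁻¹ du` (GGP 2012, §22: "`f ↦ ∫_{U(F)\U(𝔸)} f(u) θ̄(u) du` …
known as the `θ`-Fourier coefficient"; GRS 2011, Ch. 3), with the compact quotient realised by a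
(Haar) measure `ν` on `N(𝔸_F)` and a fundamental domain `𝓕` of `N(F)`, normalised to mass one:
`whittakerCoeff ν 𝓕 ψ ψ₀ φ g = (ν 𝓕)⁻¹ ∫_𝓕 φ(u g) conj(θ_{ψ,ψ₀}(u)) dν(u)` (`θ⁻¹ = θ̄`, `θ` being
unitary) — the same shape as the accepted `whittakerCoeff` for `GL_n`. For `φ` left `U(F)`-invariant
and `ψ, ψ₀` trivial on `E` the value does not depend on `𝓕`
(`whittakerCoeff_eq_of_isFundamentalDomain`). Junk value `0` if `ν 𝓕 ∈ {0, ∞}`. [cite: GanGrossPrasad2012, §22] -/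
def whittakerCoeff (ν : Measure (adelicUnipotent F E c N)) (𝓕 : Set (adelicUnipotent F E c N))
    (ψ ψ₀ : AddChar (AdeleRing (𝓞 E) E) Circle) (φ : (quasiSplit F E c N).Adelic → ℂ)
    (g : (quasiSplit F E c N).Adelic) : ℂ :=
  ((ν 𝓕).toReal⁻¹ : ℝ) •
    ∫ u in 𝓕, φ ((u : (quasiSplit F E c N).Adelic) * g) * conj (genericChar ψ ψ₀ u) ∂ν

/-- Unfolding `whittakerCoeff`. [folklore] -/
theorem whittakerCoeff_def (ν : Measure (adelicUnipotent F E c N)) (𝓕 : Set (adelicUnipotent F E c N))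
    (ψ ψ₀ : AddChar (AdeleRing (𝓞 E) E) Circle) (φ : (quasiSplit F E c N).Adelic → ℂ)
    (g : (quasiSplit F E c N).Adelic) :
    whittakerCoeff ν 𝓕 ψ ψ₀ φ g = ((ν 𝓕).toReal⁻¹ : ℝ) •
      ∫ u in 𝓕, φ ((u : (quasiSplit F E c N).Adelic) * g) * conj (genericChar ψ ψ₀ u) ∂ν :=
  rfl

/-- The Whittaker coefficient of `0` is `0`. [folklore] -/
@[simp] theorem whittakerCoeff_zero (ν : Measure (adelicUnipotent F E c N))
    (𝓕 : Set (adelicUnipotent F E c N)) (ψ ψ₀ : AddChar (AdeleRing (𝓞 E) E) Circle)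
    (g : (quasiSplit F E c N).Adelic) :
    whittakerCoeff ν 𝓕 ψ ψ₀ (0 : (quasiSplit F E c N).Adelic → ℂ) g = 0 := by
  simp [whittakerCoeff]

/-- `whittakerCoeff` is additive in `φ` (given integrability on `𝓕`). [folklore] -/
theorem whittakerCoeff_add (ν : Measure (adelicUnipotent F E c N)) (𝓕 : Set (adelicUnipotent F E c N))
    (ψ ψ₀ : AddChar (AdeleRing (𝓞 E) E) Circle) {φ₁ φ₂ : (quasiSplit F E c N).Adelic → ℂ}
    (g : (quasiSplit F E c N).Adelic)
    (h₁ : IntegrableOn (fun u : adelicUnipotent F E c N =>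
      φ₁ ((u : (quasiSplit F E c N).Adelic) * g) * conj (genericChar ψ ψ₀ u)) 𝓕 ν)
    (h₂ : IntegrableOn (fun u : adelicUnipotent F E c N =>
      φ₂ ((u : (quasiSplit F E c N).Adelic) * g) * conj (genericChar ψ ψ₀ u)) 𝓕 ν) :
    whittakerCoeff ν 𝓕 ψ ψ₀ (φ₁ + φ₂) g =
      whittakerCoeff ν 𝓕 ψ ψ₀ φ₁ g + whittakerCoeff ν 𝓕 ψ ψ₀ φ₂ g := by
  simp only [whittakerCoeff, Pi.add_apply, add_mul]
  rw [integral_add h₁ h₂, smul_add]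

/-- `whittakerCoeff` is homogeneous in `φ`. [folklore] -/
theorem whittakerCoeff_const_smul (ν : Measure (adelicUnipotent F E c N))
    (𝓕 : Set (adelicUnipotent F E c N)) (ψ ψ₀ : AddChar (AdeleRing (𝓞 E) E) Circle) (a : ℂ)
    (φ : (quasiSplit F E c N).Adelic → ℂ) (g : (quasiSplit F E c N).Adelic) :
    whittakerCoeff ν 𝓕 ψ ψ₀ (a • φ) g = a * whittakerCoeff ν 𝓕 ψ ψ₀ φ g := by
  simp only [whittakerCoeff, Pi.smul_apply, smul_eq_mul, mul_assoc, integral_const_mul,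
    Complex.real_smul]
  ring

/-- `whittakerCoeff` of `-φ`. [folklore] -/
theorem whittakerCoeff_neg (ν : Measure (adelicUnipotent F E c N))
    (𝓕 : Set (adelicUnipotent F E c N)) (ψ ψ₀ : AddChar (AdeleRing (𝓞 E) E) Circle)
    (φ : (quasiSplit F E c N).Adelic → ℂ) (g : (quasiSplit F E c N).Adelic) :
    whittakerCoeff ν 𝓕 ψ ψ₀ (-φ) g = -whittakerCoeff ν 𝓕 ψ ψ₀ φ g := by
  rw [show -φ = (-1 : ℂ) • φ by simp, whittakerCoeff_const_smul, neg_one_mul]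

omit [MeasurableSpace (adelicUnipotent F E c N)] in
/-- **`N(F)`-invariance of the Whittaker integrand.** If `φ` is left `U(F)`-invariant
(`IsLeftInvariant`, e.g. an automorphic form on `U_{E/F}(N)`) and `ψ, ψ₀` are trivial on `E`, then
for `γ ∈ N(F)`: `φ((γ u) g) θ̄(γ u) = φ(u g) θ̄(u)`, so the integrand is a function on
`N(F) \ N(𝔸_F)` (GGP 2012, §22). [folklore] -/
theorem whittakerIntegrand_smul {ψ ψ₀ : AddChar (AdeleRing (𝓞 E) E) Circle}
    (hψ : ∀ e : E, ψ (algebraMap E (AdeleRing (𝓞 E) E) e) = 1)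
    (hψ₀ : ∀ e : E, ψ₀ (algebraMap E (AdeleRing (𝓞 E) E) e) = 1)
    {φ : (quasiSplit F E c N).Adelic → ℂ} (hφ : IsLeftInvariant (quasiSplit F E c N) φ)
    (g : (quasiSplit F E c N).Adelic) (γ : rationalUnipotent F E c N) (u : adelicUnipotent F E c N) :
    φ (((γ • u : adelicUnipotent F E c N) : (quasiSplit F E c N).Adelic) * g) *
        conj (genericChar ψ ψ₀ (γ • u)) =
      φ ((u : (quasiSplit F E c N).Adelic) * g) * conj (genericChar ψ ψ₀ u) := by
  have hγu : (γ • u : adelicUnipotent F E c N) = (γ : adelicUnipotent F E c N) * u := rfl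
  rw [hγu, genericChar_mul, genericChar_eq_one_of_mem_rationalUnipotent hψ hψ₀ γ.2, one_mul,
    Subgroup.coe_mul, mul_assoc]
  congr 1
  exact hφ _ γ.2 _

/-- Hence the Whittaker coefficient of a left `U(F)`-invariant `φ` **does not depend on the fundamental
domain**: two fundamental domains of `N(F)` in `N(𝔸_F)` for an `N(F)`-invariant measure give the same
integral (Mathlib `IsFundamentalDomain.setIntegral_eq`) and the same mass
(`IsFundamentalDomain.measure_eq`). [folklore] -/
theorem whittakerCoeff_eq_of_isFundamentalDomain [Countable (rationalUnipotent F E c N)]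
    {ν : Measure (adelicUnipotent F E c N)}
    [MeasurableConstSMul (rationalUnipotent F E c N) (adelicUnipotent F E c N)]
    [SMulInvariantMeasure (rationalUnipotent F E c N) (adelicUnipotent F E c N) ν]
    {𝓕 𝓕' : Set (adelicUnipotent F E c N)} (h𝓕 : IsFundamentalDomain (rationalUnipotent F E c N) 𝓕 ν)
    (h𝓕' : IsFundamentalDomain (rationalUnipotent F E c N) 𝓕' ν)
    {ψ ψ₀ : AddChar (AdeleRing (𝓞 E) E) Circle}
    (hψ : ∀ e : E, ψ (algebraMap E (AdeleRing (𝓞 E) E) e) = 1)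
    (hψ₀ : ∀ e : E, ψ₀ (algebraMap E (AdeleRing (𝓞 E) E) e) = 1)
    {φ : (quasiSplit F E c N).Adelic → ℂ} (hφ : IsLeftInvariant (quasiSplit F E c N) φ)
    (g : (quasiSplit F E c N).Adelic) :
    whittakerCoeff ν 𝓕 ψ ψ₀ φ g = whittakerCoeff ν 𝓕' ψ ψ₀ φ g := by
  rw [whittakerCoeff, whittakerCoeff, h𝓕.measure_eq h𝓕',
    h𝓕.setIntegral_eq h𝓕' (f := fun u : adelicUnipotent F E c N =>
      φ ((u : (quasiSplit F E c N).Adelic) * g) * conj (genericChar ψ ψ₀ u))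
      (fun γ u => whittakerIntegrand_smul hψ hψ₀ hφ g γ u)]

end Coefficient

/-! ## Whittaker data and global genericity -/

variable (F E c N)

/-- A **global additive character of `E` modulo the base `F`**: a non-trivial continuous character
`ψ₀ : 𝔸_E → 𝕊¹` trivial on `E` (accepted `IsGlobalAddChar`) AND on the base-changed adeles
`𝔸_F ↪ 𝔸_E` (accepted `AdeleRing.baseChange`), i.e. a non-trivial character of
`𝔸_E / (E + 𝔸_F)` — Gan–Gross–Prasad (2012), §23: "a fixed nontrivial additive character
`ψ₀ : 𝔸_E/(E + 𝔸) → 𝕊¹`" (hermitian case). Since `𝔸_E = 𝔸_F ⊕ 𝔸_E^{c = -1}`, these are the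
non-trivial characters of the trace-zero adeles modulo the trace-zero elements of `E`; e.g.
`x ↦ ψ_F(Tr_{E/F}(δ x))` with `c δ = -δ ≠ 0`. [cite: GanGrossPrasad2012, §23] -/
structure IsGlobalAddCharModBase (ψ₀ : AddChar (AdeleRing (𝓞 E) E) Circle) : Prop where
  /-- `ψ₀` is a global additive character of `E` (continuous, trivial on `E`, non-trivial). -/
  isGlobalAddChar : IsGlobalAddChar E ψ₀
  /-- `ψ₀` is trivial on `𝔸_F ⊆ 𝔸_E`. -/
  map_baseChange : ∀ x : AdeleRing (𝓞 F) F, ψ₀ (AdeleRing.baseChange F E x) = 1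

/-- A **Whittaker datum for `U_{E/F}(N)`** relative to its standard Borel subgroup, as a pair of
additive characters of `𝔸_E`: `ψ` a global additive character of `E` (for the free simple-root
coordinates) and, when `N` is even, `ψ₀` a non-trivial character of `𝔸_E/(E + 𝔸_F)` (for the
trace-zero middle coordinate); for `N` odd `ψ₀` is unconstrained and unused. The attached generic
character is `genericChar ψ ψ₀`. Gan–Gross–Prasad (2012), §12 (Prop. 12.1: one `T(F)`-orbit of
generic characters for `N` odd, an `F^×/N E^×`-torsor of them for `N` even) and §23; Mok 2014, §3.1
(standard Whittaker datum `(B, λ)`). [cite: GanGrossPrasad2012, §12 and §23] -/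
structure IsWhittakerDatum (ψ ψ₀ : AddChar (AdeleRing (𝓞 E) E) Circle) : Prop where
  /-- `ψ` is a global additive character of `E`. -/
  isGlobalAddChar : IsGlobalAddChar E ψ
  /-- For `N` even, `ψ₀` is a non-trivial character of `𝔸_E / (E + 𝔸_F)`. -/
  modBase_of_even : Even N → IsGlobalAddCharModBase F E ψ₀

variable {F E c N} in
/-- The characters of a Whittaker datum are trivial on `E`: `ψ|_E = 1`. [folklore] -/
theorem IsWhittakerDatum.map_algebraMap {ψ ψ₀ : AddChar (AdeleRing (𝓞 E) E) Circle}
    (h : IsWhittakerDatum F E N ψ ψ₀) (e : E) : ψ (algebraMap E (AdeleRing (𝓞 E) E) e) = 1 :=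
  h.isGlobalAddChar.map_algebraMap e

variable {F E c N} in
/-- For a Whittaker datum the generic character is trivial on `N(F)` (for `N` odd `ψ₀` does not
enter; for `N` even `ψ₀|_E = 1`). [folklore] -/
theorem IsWhittakerDatum.genericChar_eq_one {ψ ψ₀ : AddChar (AdeleRing (𝓞 E) E) Circle}
    (h : IsWhittakerDatum F E N ψ ψ₀) {u : adelicUnipotent F E c N}
    (hu : u ∈ rationalUnipotent F E c N) : genericChar ψ ψ₀ u = 1 := by
  rcases Nat.even_or_odd N with hN | hN
  · exact genericChar_eq_one_of_mem_rationalUnipotent h.map_algebraMap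
      (h.modBase_of_even hN).isGlobalAddChar.map_algebraMap hu
  · obtain ⟨γ, hγ⟩ := (mem_rationalUnipotent_iff u).1 hu
    rw [genericChar_eq_of_odd hN]
    have h1 := genericChar_eq_one_of_mem_rationalUnipotent (ψ := ψ) (ψ₀ := ψ) h.map_algebraMap
      h.map_algebraMap hu
    rwa [genericChar_eq_of_odd hN] at h1

/-- **`φ` has a non-vanishing `θ_{ψ,ψ₀}`-Whittaker–Fourier coefficient**: for every Borel structure on
`N(𝔸_F)`, every Haar measure `ν` and every fundamental domain `𝓕` of `N(F)` (the set-up of the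
accepted `CuspCondition`), `W_φ(g) ≠ 0` for some `g ∈ U(𝔸_F)` — the `θ`-Fourier coefficient
`F(θ)` of GGP (2012), §22 does not vanish on the translates of `φ`. [cite: GanGrossPrasad2012, §22] -/
def HasNonzeroWhittakerCoeff (ψ ψ₀ : AddChar (AdeleRing (𝓞 E) E) Circle)
    (φ : (quasiSplit F E c N).Adelic → ℂ) : Prop :=
  ∀ [MeasurableSpace (adelicUnipotent F E c N)] [BorelSpace (adelicUnipotent F E c N)]
    (ν : Measure (adelicUnipotent F E c N)) [ν.IsHaarMeasure] (𝓕 : Set (adelicUnipotent F E c N)),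
    IsFundamentalDomain (rationalUnipotent F E c N) 𝓕 ν →
      ∃ g : (quasiSplit F E c N).Adelic, whittakerCoeff ν 𝓕 ψ ψ₀ φ g ≠ 0

variable {F E c N} in
/-- Non-vanishing of Whittaker coefficients is stable under non-zero scalars. [folklore] -/
theorem HasNonzeroWhittakerCoeff.smul {ψ ψ₀ : AddChar (AdeleRing (𝓞 E) E) Circle}
    {φ : (quasiSplit F E c N).Adelic → ℂ} (h : HasNonzeroWhittakerCoeff F E c N ψ ψ₀ φ) {a : ℂ}
    (ha : a ≠ 0) : HasNonzeroWhittakerCoeff F E c N ψ ψ₀ (a • φ) := by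
  intro _ _ ν _ 𝓕 h𝓕
  obtain ⟨g, hg⟩ := h ν 𝓕 h𝓕
  exact ⟨g, by rw [whittakerCoeff_const_smul]; exact mul_ne_zero ha hg⟩

variable {F E c N} in
/-- Non-vanishing of Whittaker coefficients is stable under `φ ↦ -φ`. [folklore] -/
theorem HasNonzeroWhittakerCoeff.neg {ψ ψ₀ : AddChar (AdeleRing (𝓞 E) E) Circle}
    {φ : (quasiSplit F E c N).Adelic → ℂ} (h : HasNonzeroWhittakerCoeff F E c N ψ ψ₀ φ) :
    HasNonzeroWhittakerCoeff F E c N ψ ψ₀ (-φ) := by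
  rw [show -φ = (-1 : ℂ) • φ by simp]
  exact h.smul (by norm_num)

variable (hcpt : isCompact_glFiniteIntegralLevel N E)

/-- **`π` is globally `θ_{ψ,ψ₀}`-generic** (`π = W/W'` automorphic representation data of
`U_{E/F}(N)`, accepted `AutomorphicRepData` for `quasiSplitDatum`): some `φ ∈ W ∖ W'` has, together
with every element of its coset `φ + W'`, a non-vanishing `θ`-Whittaker–Fourier coefficient
(`HasNonzeroWhittakerCoeff`). For a subrepresentation (`W' = ⊥`) this reads "some `φ ∈ π` has
`W_φ ≠ 0`" (`isGenericFor_iff_of_eq_bot`) — Gan–Gross–Prasad (2012), §22: "if `F(θ)` is nonzero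
when restricted to `π ⊂ 𝒜(G)`, we say that `π` is globally generic with respect to `θ`"; for a
subquotient it says that the `θ`-Whittaker map `φ ↦ W_φ` on `W` does not factor through `W'`. [cite: GanGrossPrasad2012, §22] -/
def IsGenericFor (ψ ψ₀ : AddChar (AdeleRing (𝓞 E) E) Circle)
    (π : AutomorphicRepData (quasiSplitDatum F E c N hcpt)) : Prop :=
  ∃ φ ∈ π.W, φ ∉ π.W' ∧ ∀ φ' ∈ π.W', HasNonzeroWhittakerCoeff F E c N ψ ψ₀ (φ + φ')

/-- **`π` is globally generic** (the wanted notion `UnitaryGroup.IsGeneric`): the automorphic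
representation datum `π` of Mok's quasi-split unitary group `U_{E/F}(N)` is globally generic with
respect to SOME Whittaker datum `(ψ, ψ₀)` (`IsWhittakerDatum`, `IsGenericFor`), i.e. with respect to
some automorphic generic character `θ` of `N(F) \ N(𝔸_F)` — Gan–Gross–Prasad (2012), §22–§23
(for `N` odd all generic characters are `T(F)`-conjugate, for `N` even there are two orbits, §12);
Mok 2014, §2.5 and §3.1 (Whittaker data of `U_{E/F}(N)`); Ginzburg–Rallis–Soudry (2011), Ch. 3. [cite: GanGrossPrasad2012, §22–§23] -/
def IsGeneric (π : AutomorphicRepData (quasiSplitDatum F E c N hcpt)) : Prop :=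
  ∃ ψ ψ₀ : AddChar (AdeleRing (𝓞 E) E) Circle,
    IsWhittakerDatum F E N ψ ψ₀ ∧ IsGenericFor F E c N hcpt ψ ψ₀ π

variable {F E c N hcpt}

/-- A `θ`-generic `π` has a form `φ ∈ W ∖ W'` with non-vanishing `θ`-Whittaker coefficient (the coset
condition at `φ' = 0`). [folklore] -/
theorem IsGenericFor.exists_hasNonzeroWhittakerCoeff {ψ ψ₀ : AddChar (AdeleRing (𝓞 E) E) Circle}
    {π : AutomorphicRepData (quasiSplitDatum F E c N hcpt)} (h : IsGenericFor F E c N hcpt ψ ψ₀ π) :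
    ∃ φ ∈ π.W, φ ∉ π.W' ∧ HasNonzeroWhittakerCoeff F E c N ψ ψ₀ φ := by
  obtain ⟨φ, hφ, hφ', h⟩ := h
  refine ⟨φ, hφ, hφ', ?_⟩
  intro _ _ ν _ 𝓕 h𝓕
  simpa using h 0 (zero_mem _) ν 𝓕 h𝓕

/-- For a subrepresentation (`W' = ⊥`), `θ`-genericity is GGP's definition verbatim: some non-zero
`φ ∈ W` has a non-vanishing `θ`-Fourier coefficient. [cite: GanGrossPrasad2012, §22] -/
theorem isGenericFor_iff_of_eq_bot {ψ ψ₀ : AddChar (AdeleRing (𝓞 E) E) Circle}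
    {π : AutomorphicRepData (quasiSplitDatum F E c N hcpt)} (hπ : π.W' = ⊥) :
    IsGenericFor F E c N hcpt ψ ψ₀ π ↔
      ∃ φ ∈ π.W, φ ≠ 0 ∧ HasNonzeroWhittakerCoeff F E c N ψ ψ₀ φ := by
  constructor
  · rintro ⟨φ, hφ, hφ', h⟩
    refine ⟨φ, hφ, fun h0 => hφ' (by rw [h0]; exact zero_mem _), ?_⟩
    intro _ _ ν _ 𝓕 h𝓕
    simpa using h 0 (zero_mem _) ν 𝓕 h𝓕
  · rintro ⟨φ, hφ, hφ0, h⟩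
    refine ⟨φ, hφ, fun hφ' => hφ0 ?_, fun φ' hφ' => ?_⟩
    · rwa [hπ, Submodule.mem_bot] at hφ'
    · rw [hπ, Submodule.mem_bot] at hφ'
      subst hφ'
      intro _ _ ν _ 𝓕 h𝓕
      simpa using h ν 𝓕 h𝓕

/-- Genericity with respect to a Whittaker datum implies genericity. [folklore] -/
theorem IsGenericFor.isGeneric {ψ ψ₀ : AddChar (AdeleRing (𝓞 E) E) Circle}
    {π : AutomorphicRepData (quasiSplitDatum F E c N hcpt)} (h𝔀 : IsWhittakerDatum F E N ψ ψ₀)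
    (h : IsGenericFor F E c N hcpt ψ ψ₀ π) : IsGeneric F E c N hcpt π :=
  ⟨ψ, ψ₀, h𝔀, h⟩

/-- A generic `π` has, for some Whittaker datum, a form `φ ∈ W ∖ W'` with non-vanishing Whittaker
coefficient. [folklore] -/
theorem IsGeneric.exists {π : AutomorphicRepData (quasiSplitDatum F E c N hcpt)}
    (h : IsGeneric F E c N hcpt π) :
    ∃ ψ ψ₀ : AddChar (AdeleRing (𝓞 E) E) Circle, IsWhittakerDatum F E N ψ ψ₀ ∧
      ∃ φ ∈ π.W, φ ∉ π.W' ∧ HasNonzeroWhittakerCoeff F E c N ψ ψ₀ φ := by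
  obtain ⟨ψ, ψ₀, h𝔀, h⟩ := h
  exact ⟨ψ, ψ₀, h𝔀, h.exists_hasNonzeroWhittakerCoeff⟩

end UnitaryGroup

end Literature.NumberTheory.Automorphic
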